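import Literature.NumberTheory.LFunctions.SatheSelberg
import HarnessLib

/-!
# The Sathe–Selberg Euler product `F_x(z)` and `G_x(z) = F_x(z)/Γ(z+1)` for complex `z`

Topic `NumberTheory/LFunctions`; companion to `SatheSelberg.lean` (the named fact
`MontgomeryVaughan2007_exercise_7_4_3c`, the Sathe–Selberg formula for `ω`). That file works with
the real-exponent product `satheSelbergF x r = ∏_{p ≤ x} (1 + r/(p-1))(1 - 1/p)^r` and
`satheSelbergG x r = satheSelbergF x r / Γ(r+1)`, which is all the STATEMENT needs (the exponent
there is `r = (k-1)/log log x ≥ 0`). The PROOF of the formula (Montgomery–Vaughan, *Multiplicative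
Number Theory I*, proof of Theorem 7.19, p. 180, and Theorem 7.18 with §7.4.1 Exercise 3) runs
through the mean value of `z^{ω(n)}` for COMPLEX `z` and Cauchy's formula on the circle
`|z| = (k-1)/log log x`, and so needs the same products as entire functions of a complex variable.
This small file provides them once:

* `satheSelbergFC x z = ∏_{p ≤ x} (1 + z/(p-1)) (1 - 1/p)^z` (principal complex power of the
  positive real base `1 - 1/p`), with `satheSelbergFC_ofReal : F_x(r : ℂ) = (satheSelbergF x r : ℂ)`,
  `satheSelbergFC_zero : F_x(0) = 1`, `differentiable_satheSelbergFC` (entire);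
* `satheSelbergGC x z = satheSelbergFC x z / Γ(z+1)` (Mathlib's `Complex.Gamma`; `1/Γ` is entire and
  Mathlib's values `Γ(-n) = 0` make `(Γ ·)⁻¹` the genuine entire function), with
  `satheSelbergGC_ofReal`, `satheSelbergGC_zero`, `differentiable_satheSelbergGC`.

Everything here is a definition with a body or a proved lemma; no named facts.

## References

* [MontgomeryVaughan2007] H. L. Montgomery, R. C. Vaughan, *Multiplicative Number Theory I*, CUP
  2007, §7.4: Theorem 7.18, proof of Theorem 7.19 (p. 180), §7.4.1 Exercise 3(a)–(d).
  doi:10.1017/CBO9780511618314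
-/

noncomputable section

namespace Literature.NumberTheory.LFunctions

open Finset Complex

/-- The complex Euler factor product `F_x(z) = ∏_{p ≤ x} (1 + z/(p - 1)) (1 - 1/p)^z`
(complex `z`; the value at `s = 1` of `F(s,z) = ∏_p (1 + z/(p^s - 1))(1 - p^{-s})^z` truncated at
`p ≤ x`), extending `satheSelbergF` to complex exponents.
[cite: MontgomeryVaughan2007, §7.4.1 Exercise 3(a)] -/
def satheSelbergFC (x : ℕ) (z : ℂ) : ℂ :=
  ∏ p ∈ Nat.primesLE x, ((1 : ℂ) + z / ((p : ℂ) - 1)) * ((1 : ℂ) - 1 / (p : ℂ)) ^ z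

/-- `G_x(z) = F_x(z)/Γ(z + 1)` for complex `z` (the function `G` of Montgomery–Vaughan's
Theorem 7.19 / §7.4.1 Exercise 3(c), with the Euler product truncated at `p ≤ x`), extending
`satheSelbergG`. [cite: MontgomeryVaughan2007, §7.4.1 Exercise 3(c)] -/
def satheSelbergGC (x : ℕ) (z : ℂ) : ℂ :=
  satheSelbergFC x z / Complex.Gamma (z + 1)

/-- Unfolding of `satheSelbergFC`. [cite: MontgomeryVaughan2007, §7.4.1 Exercise 3(a)] -/
theorem satheSelbergFC_apply (x : ℕ) (z : ℂ) :
    satheSelbergFC x z =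
      ∏ p ∈ Nat.primesLE x, ((1 : ℂ) + z / ((p : ℂ) - 1)) * ((1 : ℂ) - 1 / (p : ℂ)) ^ z :=
  rfl

/-- Unfolding of `satheSelbergGC`. [cite: MontgomeryVaughan2007, §7.4.1 Exercise 3(c)] -/
theorem satheSelbergGC_apply (x : ℕ) (z : ℂ) :
    satheSelbergGC x z = satheSelbergFC x z / Complex.Gamma (z + 1) :=
  rfl

/-- `F_x(0) = 1`. [cite: MontgomeryVaughan2007, §7.4.1 Exercise 3(d)] -/
@[simp] theorem satheSelbergFC_zero (x : ℕ) : satheSelbergFC x 0 = 1 := by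
  simp [satheSelbergFC]

/-- `G_x(0) = 1` (Exercise 3(d): `G(0) = 1`). [cite: MontgomeryVaughan2007, §7.4.1 Exercise 3(d)] -/
@[simp] theorem satheSelbergGC_zero (x : ℕ) : satheSelbergGC x 0 = 1 := by
  simp [satheSelbergGC]

/-- On real exponents the complex product is the real one: `F_x(r) = satheSelbergF x r`.
[cite: MontgomeryVaughan2007, §7.4.1 Exercise 3(a)] -/
theorem satheSelbergFC_ofReal (x : ℕ) (r : ℝ) :
    satheSelbergFC x (r : ℂ) = ((satheSelbergF x r : ℝ) : ℂ) := by
  rw [satheSelbergF_apply, satheSelbergFC_apply, Complex.ofReal_prod]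
  refine Finset.prod_congr rfl fun p hp => ?_
  have hp2 : (2 : ℝ) ≤ p := by exact_mod_cast (Nat.mem_primesLE.1 hp).2.two_le
  have h0 : (0 : ℝ) ≤ 1 - 1 / (p : ℝ) := by
    rw [sub_nonneg, div_le_one (by linarith)]; linarith
  rw [Complex.ofReal_mul, Complex.ofReal_cpow h0]
  push_cast
  ring

/-- On real exponents, `G_x(r : ℂ) = satheSelbergG x r`. [cite: MontgomeryVaughan2007, §7.4.1 Exercise 3(c)] -/
theorem satheSelbergGC_ofReal (x : ℕ) (r : ℝ) :
    satheSelbergGC x (r : ℂ) = ((satheSelbergG x r : ℝ) : ℂ) := by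
  rw [satheSelbergGC_apply, satheSelbergG_apply, satheSelbergFC_ofReal, Complex.ofReal_div,
    ← Complex.ofReal_one, ← Complex.ofReal_add, Complex.Gamma_ofReal]

/-- The bases `1 - 1/p` (`p` prime) are non-zero complex numbers. [folklore] -/
theorem one_sub_one_div_prime_ne_zero {p : ℕ} (hp : p.Prime) : (1 : ℂ) - 1 / (p : ℂ) ≠ 0 := by
  have hp2 : (2 : ℝ) ≤ p := by exact_mod_cast hp.two_le
  have : ((1 - 1 / (p : ℝ) : ℝ) : ℂ) = (1 : ℂ) - 1 / (p : ℂ) := by push_cast; ring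
  rw [← this, Complex.ofReal_ne_zero]
  have : 1 / (p : ℝ) ≤ 1 / 2 := one_div_le_one_div_of_le (by norm_num) hp2
  linarith

/-- `F_x` is an entire function of `z` (a finite product of entire functions).
[cite: MontgomeryVaughan2007, §7.4.1 Exercise 3(a)] -/
theorem differentiable_satheSelbergFC (x : ℕ) : Differentiable ℂ (satheSelbergFC x) := by
  unfold satheSelbergFC
  refine Differentiable.fun_finsetProd fun p hp => ?_
  refine Differentiable.mul ?_ (differentiable_id.const_cpow
    (Or.inl (one_sub_one_div_prime_ne_zero (Nat.mem_primesLE.1 hp).2)))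
  fun_prop

/-- `G_x` is an entire function of `z` (`1/Γ` is entire). [cite: MontgomeryVaughan2007, §7.4.1 Exercise 3(c)] -/
theorem differentiable_satheSelbergGC (x : ℕ) : Differentiable ℂ (satheSelbergGC x) := by
  have h1 : Differentiable ℂ fun z : ℂ => (Complex.Gamma (z + 1))⁻¹ :=
    Complex.differentiable_one_div_Gamma.comp (differentiable_id.add_const 1)
  have : satheSelbergGC x = fun z => satheSelbergFC x z * (Complex.Gamma (z + 1))⁻¹ := by
    funext z; rw [satheSelbergGC_apply, div_eq_mul_inv]
  rw [this]
  exact (differentiable_satheSelbergFC x).mul h1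

end Literature.NumberTheory.LFunctions

end
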